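/-
Copyright (c) 2026 the pub-hodgecm-mathlib formalisation cell (harness21).  Prover seat hodgecm-mathlib-R90-C131-p02 (g0) (R90-TF S4 hand lent to L1
by CHAIR VALVE WORD W4), Track B «K2-LIT», hLiu418 = `stmt-HodgeConjecture-24832`; K1-a♮ line lead K2E5-p16 (g8) DESK NAME 01:27Z «(iii-b-3)», docking file.
THEOREMS ONLY (no `def`, no instance, no notation, no named-fact hypothesis, no `sorry`); lane `--supports stmt-HodgeConjecture-24832 --as helper`.
-/
import Summits.HodgeConjecture.HodgeConjecture.Theorems.K2LiuArchTwistedKTypeBlockRung          -- ★ FILE 3: the first rung, `T ≥ 0`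
import Summits.HodgeConjecture.HodgeConjecture.Theorems.K2LiuArchTwistedKTypeBlockRungNeg       -- ★ FILE 3⁻: the first rung, `T ≤ 0`
import Summits.HodgeConjecture.HodgeConjecture.Theorems.K2LiuArchTwistedKTypeBlockContinuation  -- ★ ED. 2: `single_one_one_eq_swap_conj`, `norm_det_swapTwo`
import HarnessLib

/-!
# Crux `HLiu418`, (Φ-S1) road B, (iii-b-3) docking: the first non-scalar rung's arch letters AT THE CORNER INDEX `Matrix.single 1 1 σ` of ★ (K1a-T)
# (`σ > 0` over ★ FILE 3, `σ < 0` over ★ FILE 3⁻; `single 1 1 σ = swap·hermTwo(σ,0,0)·swapᴴ`, ★ `norm_det_swapTwo`)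

Cell `hodgecm-mathlib`, crux item hLiu418 = `stmt-HodgeConjecture-24832` (helper lane, count-neutral).  As ★ `exists_archLetters_scalarType_corner{,_neg}`
(★ p863874) did for the scalar type: the rung letters of ★ `exists_archLetters_rung` ∕ ★ `exists_archLetters_rung_neg` rewritten at the corner index of ★
`exists_cornerData_of_record`'s presentation `W_S(f)(h) = W_{single 1 1 (σc S)}(f)(gc S · h)`, for either sign of the real corner value `σ`.
* §1 **`exists_archLetters_rung_corner`** (`σ > 0`, `k/2 < N`), **`exists_archLetters_rung_corner_neg`** (`σ < 0`, `−k/2 < N`).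

HONEST LABEL: one rung above the scalar type; closes no socket.  HC_CM is proved only modulo the 7 printed citations (2 remaining named inputs: hLiu418 =
`stmt-HodgeConjecture-24832`, h413 = `stmt-HodgeConjecture-24833`) until rung 0 closes.  REL ≠ ★ ≠ BUILT.

## References
* [Shimura1982] G. Shimura, *Confluent hypergeometric functions on tube domains*, Math. Ann. 260 (1982), §4 Thm. 4.2.
* [LeeZhu1998] S. T. Lee, C.-B. Zhu, *Degenerate principal series and local theta correspondence II*, Israel J. Math. 100 (1997/98), §5.
-/

set_option autoImplicit false
set_option linter.dupNamespace false

noncomputable section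

open Complex Matrix NormedSpace MeasureTheory
open scoped ComplexConjugate ComplexOrder

namespace Summit.HodgeConjecture.HodgeConjecture.Cruxes.HLiu418.K2LiuArchTwistedKTypeBlockRungCorner

open Summit.HodgeConjecture.HodgeConjecture.Cruxes.HLiu418.K2LiuHermTwoGammaDefs
open Summit.HodgeConjecture.HodgeConjecture.Cruxes.HLiu418.K2LiuArchInducedTubeDefs
open Summit.HodgeConjecture.HodgeConjecture.Cruxes.HLiu418.K2LiuArchTwistedKTypeBlockContinuation (single_one_one_eq_swap_conj single_one_one_eq_neg_swap_conj norm_det_swapTwo)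
open Summit.HodgeConjecture.HodgeConjecture.Cruxes.HLiu418.K2LiuArchTwistedKTypeBlockRung (exists_archLetters_rung)
open Summit.HodgeConjecture.HodgeConjecture.Cruxes.HLiu418.K2LiuArchTwistedKTypeBlockRungNeg (exists_archLetters_rung_neg)

/-! ## §1 The corner index -/

/-- **THE FIRST RUNG'S ARCH LETTERS AT A POSITIVE CORNER INDEX `single 1 1 σ`, `σ > 0`** (`k/2 < N`). [Shimura1982, §4 Thm. 4.2] [LeeZhu1998, §5] -/
theorem exists_archLetters_rung_corner (k : ℤ) (α β γ δ : Matrix (Fin 2) (Fin 2) ℂ)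
    (hX : (fromBlocks 1 1 (I • 1) (-(I • 1)) * fromBlocks α β γ δ * ((2 : ℂ)⁻¹ • fromBlocks 1 (-(I • 1)) 1 (I • 1)) : Matrix (Fin 2 ⊕ Fin 2) (Fin 2 ⊕ Fin 2) ℂ)ᴴ * Matrix.J (Fin 2) ℂ + Matrix.J (Fin 2) ℂ * (fromBlocks 1 1 (I • 1) (-(I • 1)) * fromBlocks α β γ δ * ((2 : ℂ)⁻¹ • fromBlocks 1 (-(I • 1)) 1 (I • 1)) : Matrix (Fin 2 ⊕ Fin 2) (Fin 2 ⊕ Fin 2) ℂ) = 0)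
    {σ : ℝ} (hσ : 0 < σ) {N : ℕ} (hN : (k : ℝ) / 2 < N) :
    ∃ Ac₁ : ℂ → Matrix (Fin 2 ⊕ Fin 2) (Fin 2 ⊕ Fin 2) ℂ → ℂ,
      (∀ h : Matrix (Fin 2 ⊕ Fin 2) (Fin 2 ⊕ Fin 2) ℂ, hᴴ * Matrix.J (Fin 2) ℂ * h = Matrix.J (Fin 2) ℂ →
        DifferentiableOn ℂ (fun s => Ac₁ s h) {s : ℂ | 0 < s.re}) ∧
      (∀ s : ℂ, 1 / 2 < s.re → ∀ h : Matrix (Fin 2 ⊕ Fin 2) (Fin 2 ⊕ Fin 2) ℂ, hᴴ * Matrix.J (Fin 2) ℂ * h = Matrix.J (Fin 2) ℂ →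
        (∫ r : Fin 2 → Fin 2 → ℝ, cexp (-(2 * Real.pi * I) * ((Matrix.single 1 1 ((σ : ℝ) : ℂ) : Matrix (Fin 2) (Fin 2) ℂ) * hermOfReal r).trace) *
          (fun y : Matrix (Fin 2 ⊕ Fin 2) (Fin 2 ⊕ Fin 2) ℂ => deriv (fun τ : ℝ => archScalarSection k s (y * NormedSpace.exp (τ • (fromBlocks 1 1 (I • 1) (-(I • 1)) * fromBlocks α β γ δ * ((2 : ℂ)⁻¹ • fromBlocks 1 (-(I • 1)) 1 (I • 1)) : Matrix (Fin 2 ⊕ Fin 2) (Fin 2 ⊕ Fin 2) ℂ)))) 0)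
            (Matrix.J (Fin 2) ℂ * fromBlocks 1 (hermOfReal r) 0 1 * h)) = Ac₁ s h) := by
  rw [single_one_one_eq_swap_conj σ]
  exact exists_archLetters_rung k α β γ δ hX norm_det_swapTwo hσ hN

/-- **THE FIRST RUNG'S ARCH LETTERS AT A NEGATIVE CORNER INDEX `single 1 1 σ`, `σ < 0`** (`−k/2 < N`). [Shimura1982, (1.28), §4 Thm. 4.2] [LeeZhu1998, §5] -/
theorem exists_archLetters_rung_corner_neg (k : ℤ) (α β γ δ : Matrix (Fin 2) (Fin 2) ℂ)
    (hX : (fromBlocks 1 1 (I • 1) (-(I • 1)) * fromBlocks α β γ δ * ((2 : ℂ)⁻¹ • fromBlocks 1 (-(I • 1)) 1 (I • 1)) : Matrix (Fin 2 ⊕ Fin 2) (Fin 2 ⊕ Fin 2) ℂ)ᴴ * Matrix.J (Fin 2) ℂ + Matrix.J (Fin 2) ℂ * (fromBlocks 1 1 (I • 1) (-(I • 1)) * fromBlocks α β γ δ * ((2 : ℂ)⁻¹ • fromBlocks 1 (-(I • 1)) 1 (I • 1)) : Matrix (Fin 2 ⊕ Fin 2) (Fin 2 ⊕ Fin 2)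 ℂ) = 0)
    {σ : ℝ} (hσ : σ < 0) {N : ℕ} (hN : -(k : ℝ) / 2 < N) :
    ∃ Ac₁ : ℂ → Matrix (Fin 2 ⊕ Fin 2) (Fin 2 ⊕ Fin 2) ℂ → ℂ,
      (∀ h : Matrix (Fin 2 ⊕ Fin 2) (Fin 2 ⊕ Fin 2) ℂ, hᴴ * Matrix.J (Fin 2) ℂ * h = Matrix.J (Fin 2) ℂ →
        DifferentiableOn ℂ (fun s => Ac₁ s h) {s : ℂ | 0 < s.re}) ∧
      (∀ s : ℂ, 1 / 2 < s.re → ∀ h : Matrix (Fin 2 ⊕ Fin 2) (Fin 2 ⊕ Fin 2) ℂ, hᴴ * Matrix.J (Fin 2) ℂ * h = Matrix.J (Fin 2) ℂ →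
        (∫ r : Fin 2 → Fin 2 → ℝ, cexp (-(2 * Real.pi * I) * ((Matrix.single 1 1 ((σ : ℝ) : ℂ) : Matrix (Fin 2) (Fin 2) ℂ) * hermOfReal r).trace) *
          (fun y : Matrix (Fin 2 ⊕ Fin 2) (Fin 2 ⊕ Fin 2) ℂ => deriv (fun τ : ℝ => archScalarSection k s (y * NormedSpace.exp (τ • (fromBlocks 1 1 (I • 1) (-(I • 1)) * fromBlocks α β γ δ * ((2 : ℂ)⁻¹ • fromBlocks 1 (-(I • 1)) 1 (I • 1)) : Matrix (Fin 2 ⊕ Fin 2) (Fin 2 ⊕ Fin 2) ℂ)))) 0)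
            (Matrix.J (Fin 2) ℂ * fromBlocks 1 (hermOfReal r) 0 1 * h)) = Ac₁ s h) := by
  rw [single_one_one_eq_neg_swap_conj σ]
  exact exists_archLetters_rung_neg k α β γ δ hX norm_det_swapTwo (neg_pos.mpr hσ) hN

end Summit.HodgeConjecture.HodgeConjecture.Cruxes.HLiu418.K2LiuArchTwistedKTypeBlockRungCorner

end
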